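import Summits.RiemannHypothesis.RiemannHypothesis.Theorems.JensenLogBandShellNearDisc
import Summits.RiemannHypothesis.RiemannHypothesis.Theorems.JensenLogBandNearFrame
import Summits.RiemannHypothesis.RiemannHypothesis.Theorems.JensenLogBandNearModelBall
import Summits.RiemannHypothesis.RiemannHypothesis.Theorems.JensenLogBandShellGlue
import Summits.RiemannHypothesis.RiemannHypothesis.Theorems.JensenLogBandShellEventually
import Summits.RiemannHypothesis.RiemannHypothesis.Theorems.JensenLogBandArcModelCompare
import Summits.RiemannHypothesis.RiemannHypothesis.Theorems.JensenLogBandArcSaddleSharp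
import HarnessLib

/-!
# The NEAR ZONE of the top shell: `stub_shellNear` (BAND crux `XiDerivBandRealAllRates`)

RH ladder column JENSEN, rung J-P(P3) «log band», BAND crux `XiDerivBandRealAllRates`
(stmt-RiemannHypothesis-19913) of route «JensenLogBand», line «band-one-window» (u-arc, top-shell
reshape), lead rh-jensen-prover g8 — the registered stub `stub_shellNear`: for `7 ≤ c < 8`,
`k ≥ k₁(c)`, in the top shell `e^{c(k−1)}/4 ≤ ‖(a+iT)²‖ < e^{ck}` and for `0 < a ≤ a₀(c) = 2/c − ¼`:
`‖U_{k,h}(−a+iT)‖ < ‖U_{k,h}(a+iT)‖`, `h = h(k,T)`. RH-FREE. WHAT THIS IS NOT: one of the two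
registered stubs of the line; nothing here bears on zeros of `ζ` off the line or the truth of RH.

Mechanism (Cauchy transfer, theory g12's frame `shellNear_of_discModels`): on the disc of radius
`2/ℓ` about `x + iT`, `|x| ≤ a₀`, the transform `U_{k,h}` is within relative error `1/3` of the
zero-free holomorphic model `M̃ = arcShiftModel k (x+iT) u₀` (`near_disc_point`), whose logarithmic
derivative has real part `≥ ℓ/2 − 14 − 1/g ≫ (1/3)/((2/ℓ)(2/3))` (`re_logDeriv_arcShiftModel_centre_ge_ell`);
the frame turns this into `∂ₓ log‖U_{k,h}(x+iT)‖ > 0` on `|x| ≤ a₀` and integrates.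
-/

noncomputable section

-- single-problem summit: `Summit.RiemannHypothesis.RiemannHypothesis.…` is the tree convention
set_option linter.dupNamespace false

open Complex Real Set Metric Filter

namespace Summit.RiemannHypothesis.RiemannHypothesis.Theorems.JensenPolynomials.LogBandArc

open Literature.NumberTheory.LFunctions

/-- **The disc models of the near zone** (hypothesis `hdisc` of `shellNear_of_discModels`): for
`7 ≤ c < 8` and `k ≥ k₁(c)`, at every admissible centre `x + iT` (`|x| ≤ 2/c − ¼`, top-shell pins)
the translated-saddle model `M̃ = arcShiftModel k (x+iT) u₀` is holomorphic and zero-free on the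
disc of radius `3/ℓ`, approximates `U_{k,h}` to relative error `1/3` on the disc of radius `2/ℓ`,
and `Re(M̃′/M̃)(x+iT) > (1/3)/((2/ℓ)(2/3))`. RH-FREE. [folklore assembly] -/
theorem near_discModels {c : ℝ} (hc7 : 7 ≤ c) (hc8 : c < 8) :
    ∃ k₁ : ℕ, ∀ k : ℕ, k₁ ≤ k → ∀ x T : ℝ, |x| ≤ 2 / c - 1 / 4 → 200 ≤ T →
      200 ≤ ell T → c * ((k : ℝ) - 1) / 2 - 4 ≤ ell T → ell T ≤ c * (k : ℝ) / 2 →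
      4 / c < bandRadius k T → bandRadius k T ≤ 4 / c + 1 / Real.log k →
      bandRadius k T ≤ 7 / 20 * T → 1 / T ≤ 2 * (2 / c - 1 / 4) →
      ∃ (M : ℂ → ℂ) (ε : ℝ), 0 ≤ ε ∧ ε < 1 ∧
        DifferentiableOn ℂ M (ball ((x : ℂ) + (T : ℂ) * I) (3 / ell T)) ∧
        (∀ z ∈ ball ((x : ℂ) + (T : ℂ) * I) (3 / ell T), M z ≠ 0) ∧
        (∀ z ∈ closedBall ((x : ℂ) + (T : ℂ) * I) (2 / ell T),
          ‖xiSqArcU k (bandRadius k T) z - M z‖ ≤ ε * ‖M z‖) ∧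
        ε / (2 / ell T * (1 - ε)) <
          (deriv M ((x : ℂ) + (T : ℂ) * I) / M ((x : ℂ) + (T : ℂ) * I)).re := by
  -- constants of the rate: `a₀ = 2/c − 1/4`
  have hc0 : 0 < c := by linarith
  have ha₀ : 0 < 2 / c - 1 / 4 := by
    rw [sub_pos, lt_div_iff₀ hc0]; linarith
  have ha₀1 : 2 / c - 1 / 4 ≤ 1 / 28 := by
    rw [sub_le_iff_le_add, div_le_iff₀ hc0]; linarith
  have h4c : 4 / c = 1 / 2 + 2 * (2 / c - 1 / 4) := by ring
  have h4c7 : 4 / c ≤ 4 / 7 := div_le_div_of_nonneg_left (by norm_num) (by norm_num) hc7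
  -- thresholds
  have t100 : ∀ᶠ k : ℕ in atTop, 100 ≤ k := eventually_ge_atTop 100
  have tA : ∀ᶠ k : ℕ in atTop, 13000 * Real.sqrt k ≤ k :=
    Filter.eventually_atTop.2 (eventually_const_mul_sqrt_le (13000 : ℝ))
  have tB : ∀ᶠ k : ℕ in atTop, 4800 / (11 * ((2 / c - 1 / 4) / 320)) * (k : ℝ) ^ 2 *
      Real.exp (-(11 * ((2 / c - 1 / 4) / 320) ^ 2 / 40 * k)) ≤ 1 :=
    Filter.eventually_atTop.2 (eventually_sq_mul_exp_neg_le (by positivity) one_pos)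
  have tC : ∀ᶠ k : ℕ in atTop, π * Real.exp 14 * (1 + 1 / ((2 / c - 1 / 4) / 2)) * (k : ℝ) ^ 2 *
      Real.exp (-(((2 / c - 1 / 4) / 320) ^ 2 / 4 * k)) ≤ (2 / c - 1 / 4) / 4 / 100 / 2 :=
    Filter.eventually_atTop.2 (eventually_sq_mul_exp_neg_le (by positivity) (by positivity))
  have tD : ∀ᶠ k : ℕ in atTop, 161280 * Real.exp 14 * (k : ℝ) ^ 2 *
      Real.exp (-(7 * ((2 / c - 1 / 4) / 4) / 4 * k)) ≤ (2 / c - 1 / 4) / 4 / 100 / 2 :=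
    Filter.eventually_atTop.2 (eventually_sq_mul_exp_neg_le (by positivity) (by positivity))
  have tL : ∀ᶠ k : ℕ in atTop, 2 * 10 ^ 4 / (2 / c - 1 / 4) * Real.exp (15 / 2) * (k : ℝ) ^ 2 *
      Real.exp (-(7 / 2 * k)) ≤ 1 :=
    Filter.eventually_atTop.2 (eventually_sq_mul_exp_neg_le (by positivity) one_pos)
  have tK : ∀ᶠ k : ℕ in atTop, ⌈10 / (2 / c - 1 / 4)⌉₊ + 3 ≤ k := eventually_ge_atTop _
  have tG : ∀ᶠ k : ℕ in atTop, ⌈Real.exp 50⌉₊ ≤ k := eventually_ge_atTop _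
  obtain ⟨k₁, hk₁⟩ := Filter.eventually_atTop.1
    (t100.and (tA.and (tB.and (tC.and (tD.and (tL.and (tK.and tG)))))))
  refine ⟨k₁, ?_⟩
  intro k hk x T hx hT hℓ hℓlo hℓhi hhc hhlog hhT h1T
  obtain ⟨hk100, hE1, hE2, hEC, hED, hEL, hK, hKG⟩ := hk₁ k hk
  clear hk₁ t100 tA tB tC tD tL tK tG hk
  have hkR : (100 : ℝ) ≤ k := by exact_mod_cast hk100
  have hk1 : (1 : ℝ) ≤ k := by linarith only [hkR]
  have hℓ0 : 0 < ell T := by linarith only [hℓ]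
  have hT0 : 0 < T := by linarith only [hT]
  -- `ℓ ≥ 32/a₀`
  have hck : 7 * ((k : ℝ) - 1) ≤ c * ((k : ℝ) - 1) :=
    mul_le_mul_of_nonneg_right hc7 (by linarith only [hkR])
  have hKR : 10 / (2 / c - 1 / 4) + 3 ≤ (k : ℝ) := by
    have h1 : (10 / (2 / c - 1 / 4) : ℝ) ≤ (⌈10 / (2 / c - 1 / 4)⌉₊ : ℝ) := Nat.le_ceil _
    have h2 : ((⌈10 / (2 / c - 1 / 4)⌉₊ + 3 : ℕ) : ℝ) ≤ (k : ℝ) := by exact_mod_cast hK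
    push_cast at h2
    linarith only [h1, h2]
  have hℓa : 32 / (2 / c - 1 / 4) ≤ ell T := by
    have : 32 / (2 / c - 1 / 4) ≤ 35 / (2 / c - 1 / 4) :=
      div_le_div_of_nonneg_right (by norm_num) ha₀.le
    have h35 : 35 / (2 / c - 1 / 4) = 7 / 2 * (10 / (2 / c - 1 / 4)) := by ring
    linarith only [this, h35, hKR, hℓlo, hck]
  -- `1/log k ≤ 1/50`, so `h ≤ 119/200`
  have hlogk : 1 / Real.log k ≤ 1 / 50 := by
    have h1 : Real.exp 50 ≤ (k : ℝ) := by
      have h2 : (Real.exp 50 : ℝ) ≤ (⌈Real.exp 50⌉₊ : ℝ) := Nat.le_ceil _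
      have h3 : ((⌈Real.exp 50⌉₊ : ℕ) : ℝ) ≤ (k : ℝ) := by exact_mod_cast hKG
      linarith only [h2, h3]
    have h4 : (50 : ℝ) ≤ Real.log k := (Real.le_log_iff_exp_le (by linarith only [hkR])).2 h1
    exact one_div_le_one_div_of_le (by norm_num) h4
  have hhub : bandRadius k T ≤ 119 / 200 := by linarith only [hhlog, h4c7, hlogk]
  have hh : 1 / 2 + 2 * (2 / c - 1 / 4) < bandRadius k T := by rw [← h4c]; exact hhc
  -- `10⁴ k² ≤ (a₀/2) T`
  have hlarge : (10 : ℝ) ^ 4 * (k : ℝ) ^ 2 ≤ (2 / c - 1 / 4) / 2 * T := by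
    have hexpℓ : Real.exp (ell T) ≤ T := by
      rw [ell, Real.exp_log (by positivity)]
      rw [div_le_iff₀ (by positivity)]
      have := Real.pi_gt_three
      nlinarith
    have hET : Real.exp (7 / 2 * k - 15 / 2) ≤ T :=
      (Real.exp_le_exp.2 (by linarith only [hℓlo, hck])).trans hexpℓ
    have hprod : Real.exp (15 / 2) * Real.exp (-(7 / 2 * (k : ℝ))) * Real.exp (7 / 2 * k - 15 / 2) = 1 := by
      rw [← Real.exp_add, ← Real.exp_add, show (15 / 2 + -(7 / 2 * (k : ℝ)) + (7 / 2 * k - 15 / 2)) = 0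
        by ring, Real.exp_zero]
    have ha₀ne : (2 / c - 1 / 4) ≠ 0 := ha₀.ne'
    have hc8ne : (2 * 4 - c) ≠ 0 := ne_of_gt (by linarith only [hc8])
    have hcne : c ≠ 0 := hc0.ne'
    calc (10 : ℝ) ^ 4 * (k : ℝ) ^ 2
        = 10 ^ 4 * (k : ℝ) ^ 2 * (Real.exp (15 / 2) * Real.exp (-(7 / 2 * (k : ℝ))) *
            Real.exp (7 / 2 * k - 15 / 2)) := by rw [hprod, mul_one]
      _ = (2 * 10 ^ 4 / (2 / c - 1 / 4) * Real.exp (15 / 2) * (k : ℝ) ^ 2 *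
            Real.exp (-(7 / 2 * k))) * ((2 / c - 1 / 4) / 2 * Real.exp (7 / 2 * k - 15 / 2)) := by
          field_simp
      _ ≤ 1 * ((2 / c - 1 / 4) / 2 * Real.exp (7 / 2 * k - 15 / 2)) :=
          mul_le_mul_of_nonneg_right hEL (by positivity)
      _ ≤ (2 / c - 1 / 4) / 2 * T := by
          rw [one_mul]; exact mul_le_mul_of_nonneg_left hET (by positivity)
  -- the centre regime and its saddle
  have hx12 : |x| ≤ 1 / 2 := hx.trans (by linarith only [ha₀1])
  have hT100 : 100 ≤ T := by linarith only [hT]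
  have hℓ20 : 20 ≤ ell T := by linarith only [hℓ]
  have hh12 : 1 / 2 ≤ bandRadius k T := by linarith only [hh, ha₀]
  have hH20 : bandRadius k T ≤ 20 := by linarith only [hhub]
  have hh0 : 0 < bandRadius k T := by linarith only [hh12]
  obtain ⟨u₀, hS₀, hu₀⟩ := exists_arcSaddleFn_eq_zero (n := k) hx12 hT100 hℓ20 hk100 hh12 hhT
  obtain ⟨hRe₀, hIm₀, -, -⟩ := arcSaddle_sharp_polar hx12 hT100 hℓ20 hk100 hh12 hhT hH20 hu₀ hS₀
  have hε₀ : (2 + 16 / 5 * bandRadius k T) / ell T ≤ (2 / c - 1 / 4) / 8 := by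
    have h1 : (2 + 16 / 5 * bandRadius k T) / ell T ≤ 3.92 / ell T :=
      div_le_div_of_nonneg_right (by linarith only [hhub]) hℓ0.le
    have h2 : 3.92 / ell T ≤ (2 / c - 1 / 4) / 8 := by
      rw [div_le_iff₀ hℓ0]
      have := (div_le_iff₀ ha₀).1 hℓa
      nlinarith only [this, ha₀]
    exact h1.trans h2
  have hε₀1 : (2 + 16 / 5 * bandRadius k T) / ell T ≤ 1 := by linarith only [hε₀, ha₀1]
  have hσ_eq : (1 / 2 + u₀).re = 1 / 2 + x + (u₀ - ((x : ℂ) + (T : ℂ) * I)).re := by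
    have e1 : (u₀ - ((x : ℂ) + (T : ℂ) * I)).re = u₀.re - x := by simp
    have e2 : (1 / 2 + u₀).re = 1 / 2 + u₀.re := by simp
    rw [e1, e2]; ring
  have hxlo : -(2 / c - 1 / 4) ≤ x := (abs_le.1 hx).1
  have hσ₀ : 1 + 7 * (2 / c - 1 / 4) / 8 ≤ (1 / 2 + u₀).re := by
    rw [hσ_eq]; linarith only [hRe₀, hε₀, hxlo, hh]
  have hg : 0 < (1 / 2 + u₀).re - 1 := by linarith only [hσ₀, ha₀]
  have hre₀ : 0 < (u₀ - ((x : ℂ) + (T : ℂ) * I)).re := by linarith only [hRe₀, hε₀, ha₀1, hh12]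
  have him₀ : |(u₀ - ((x : ℂ) + (T : ℂ) * I)).im| ≤ 1 := hIm₀.trans hε₀1
  have hw0 : arcCurv k ((x : ℂ) + (T : ℂ) * I) u₀ ≠ 0 := by
    intro h0
    have h1 := (arcCurv_re_norm hx12 hT100 hℓ20 hk100 hh12 hhT hu₀ hS₀).1
    rw [h0, Complex.zero_re] at h1
    linarith only [h1, hkR]
  have h3ℓ : 3 / ell T ≤ 3 * (2 / c - 1 / 4) / 32 := by
    rw [div_le_iff₀ hℓ0]
    have := (div_le_iff₀ ha₀).1 hℓa
    nlinarith only [this, ha₀]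
  have hR1 : 3 / ell T ≤ 1 := by linarith only [h3ℓ, ha₀1]
  have hgR : 3 / ell T < (1 / 2 + u₀).re - 1 := by linarith only [h3ℓ, hσ₀, ha₀]
  obtain ⟨hMdiff, hMne⟩ := arcShiftModel_model_on_ball k (x := x) (T := T) (u₀ := u₀)
    (R := 3 / ell T) (g := (1 / 2 + u₀).re - 1) (by linarith only [hT]) hR1 hgR
    (by linarith only [hg]) hre₀ him₀ hw0
  refine ⟨arcShiftModel k ((x : ℂ) + (T : ℂ) * I) u₀, 1 / 3, by norm_num, by norm_num, hMdiff, hMne,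
    ?_, ?_⟩
  · -- the two-sided window estimate at every disc point
    intro z hz
    have hz' : ‖z - ((x : ℂ) + (T : ℂ) * I)‖ ≤ 2 / ell T := mem_closedBall_iff_norm.1 hz
    have key := near_disc_point (x' := z.re) (T' := z.im) hc7 hc8 ha₀ ha₀1 hk100 hE1 hE2 hEC hED
      hlarge hx hT hℓ hℓa hℓlo hℓhi hh hhub hhT h1T hu₀ hS₀ hσ₀ (by rw [Complex.re_add_im]; exact hz')
    rw [Complex.re_add_im] at key
    exact key
  · -- the centre inequality
    have hM0 := hMne _ (mem_ball_self (by positivity : (0 : ℝ) < 3 / ell T))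
    have hm := re_logDeriv_arcShiftModel_centre_ge_ell hx12 hT100 hℓ20 hk100 hh12 hhT hH20 hu₀ hS₀
      (δ := (1 / 2 + u₀).re - 1) hg (by linarith only [hg]) hM0
    refine centre_ineq_of_le_third (le_refl _) hg ?_ hm
    have h1 : 4 / ((1 / 2 + u₀).re - 1) ≤ 4 / (7 * (2 / c - 1 / 4) / 8) :=
      div_le_div_of_nonneg_left (by norm_num) (by positivity) (by linarith only [hσ₀])
    have h2 : 4 / (7 * (2 / c - 1 / 4) / 8) ≤ 5 / (2 / c - 1 / 4) := by
      rw [div_le_div_iff₀ (by positivity) ha₀]; nlinarith only [ha₀]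
    have h3 : 5 / (2 / c - 1 / 4) ≤ 5 / 32 * ell T := by
      have : 5 / (2 / c - 1 / 4) = 5 / 32 * (32 / (2 / c - 1 / 4)) := by ring
      rw [this]; exact mul_le_mul_of_nonneg_left hℓa (by norm_num)
    linarith only [h1, h2, h3, hℓ]

end Summit.RiemannHypothesis.RiemannHypothesis.Theorems.JensenPolynomials.LogBandArc

namespace Summit.RiemannHypothesis.RiemannHypothesis.Cruxes.XiDerivBandRealAllRates.UArc

open Literature.NumberTheory.LFunctions
open Summit.RiemannHypothesis.RiemannHypothesis.Theorems.JensenPolynomials.LogBandArc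

/-- **stub_shellNear** (L; RH-FREE): for `7 ≤ c < 8` and `k ≥ k₁(c)`, in the top shell
`e^{c(k−1)}/4 ≤ ‖(a+iT)²‖ < e^{ck}` and for `0 < a ≤ a₀(c) = 2/c − ¼`:
`‖U_{k,h}(−a + iT)‖ < ‖U_{k,h}(a + iT)‖`. Mechanism: the disc models `near_discModels` (two-sided
saddle-window estimate against the translated-saddle model `arcShiftModel`, relative error `1/3`,
on discs of radius `2/ℓ`) fed to the Cauchy-transfer frame `shellNear_of_discModels`
(`xiSqArcU_deriv_logNorm_pos_of_near_holo` + the mean value theorem + evenness in `a`).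
WHAT THIS IS NOT: one registered stub of line band-one-window; nothing here bears on zeros of `ζ`
off the line or the truth of RH. -/
theorem stub_shellNear : ∀ c : ℝ, 7 ≤ c → c < 8 → ∃ k₁ : ℕ, ∀ k : ℕ, k₁ ≤ k → ∀ a T : ℝ,
    0 < a → a ≤ 2 / c - 1 / 4 → 0 < T →
    Real.exp (c * ((k : ℝ) - 1)) / 4 ≤ ‖((a : ℂ) + (T : ℂ) * I) ^ 2‖ →
    ‖((a : ℂ) + (T : ℂ) * I) ^ 2‖ < Real.exp (c * (k : ℝ)) →
    ‖xiSqArcU k (bandRadius k T) (-(a : ℂ) + (T : ℂ) * I)‖ <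
      ‖xiSqArcU k (bandRadius k T) ((a : ℂ) + (T : ℂ) * I)‖ :=
  fun _ hc7 hc8 => shellNear_of_discModels hc7 hc8 (near_discModels hc7 hc8)

end Summit.RiemannHypothesis.RiemannHypothesis.Cruxes.XiDerivBandRealAllRates.UArc

end
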